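import Mathlib
import Summits.Ventures.HodgeRepro.Tier4.Line1.LeftTypeOfMatrixCoeff
import Summits.Ventures.HodgeRepro.Tier4.Line1.ArchMatrixCoeff
import Summits.Ventures.HodgeRepro.Tier4.Line1.FiniteLevelIsolation

/-!
# Tier4/Line1/FiniteTypeAlgebra — the ALGEBRA of functions of finite left-`K`-type (sums, products, matrix entries,
level-coset indicators), and the coset indicators of `K_f(N) × G(k_∞)` as left-invariant test functions

Blind re-derivation cell `pub-hodge-repro`, Tier 4 (README §9–§10), seat t4-L1-p2 (gen 4), LINE L1.  Target tree path
`lean/Summits/Ventures/HodgeRepro/Tier4/Line1/FiniteTypeAlgebra.lean`.  Imports this seat's `LeftTypeOfMatrixCoeff`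
(`HasFiniteRankLeftType`), `ArchMatrixCoeff` (`finLevel`, `IsCongrFin`, `isOpen_finLevel`) and t4-L1-p4's
`FiniteLevelIsolation` (`infinitePart`, `GA.ofInfPart_mul_ofFinPart`, `GA.ofInfPart_mem_infinitePart`,
`GA.ofFinPart_mem_levelK`, `finM`, `finM_mul`, `finM_one`).  0 print.  The toolbox of plan-1's cut (S1b-BRIDGE)
(`IsolatingTestsFiniteType`): the Stone–Weierstrass approximants of a test function on `γ₀ • (K_f(N) × G(k_∞))` are
finite sums of products of archimedean matrix entries and level-coset indicators, and this file says such functions have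
a finite left-`finLevel`-type.

* `HasFiniteLeftTypeCont K f` — the ALGEBRAIC finite left-`K`-type: `f (k⁻¹ g) = ∑ i, e i k * c i g` with CONTINUOUS
  coefficients `c i` (no compact support asked).  Closed under constants, sums, scalars and PRODUCTS (the rank
  multiplies: `finProdFinEquiv`), contains the left-`K`-invariant continuous functions and the entries of every
  matrix-valued homomorphism with continuous entries (`entry`), and is antitone in `K` (`mono`).  A product with a
  left-`K`-invariant TEST function has the finite-rank type of record (`toFiniteRank`: the coefficients become test
  functions).
* on `U(W)(𝔸_k)`: `finLevel_antitone` (`M ∣ N → finLevel W N ≤ finLevel W M`), `infinitePart_le_finLevel`,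
  `exists_finLevel_conj_subset` — for every `z` and level `N₂` there is a level `N₁` with
  `z⁻¹ (K_f(N₁) × G(k_∞)) z ⊆ K_f(N₂) × G(k_∞)` (the congruence subgroups are a neighbourhood basis of `1` and `G(k_∞)`
  is normal), `isTest_indicator_of_isCompact_of_isOpen`, and `indicator_smul_finLevel_left_invariant`: the indicator of
  a coset `z • finLevel W N₂` is left-`finLevel W N₁`-invariant for that `N₁`, hence (with compactness) a left-invariant
  test function of finite type.

NOT claimed: anything about the isolating pair itself (the companion module), (S1a), `tf`, `P_T4`.  Nothing here says
anything about the status of the Hodge conjecture for CM abelian varieties, which is NOT proved (HC_CM is NOT proved by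
anyone in this repository).
-/

set_option autoImplicit false

noncomputable section

namespace Summit.Ventures.HodgeRepro.Tier4.Line1

open MeasureTheory Topology
open scoped Pointwise

namespace RTF

variable {G : Type} [Group G] [TopologicalSpace G]

section Algebra

variable (K : Subgroup G)

/-- **the algebraic finite left-`K`-type**: `f (k⁻¹ g) = ∑ i, e i k * c i g` with continuous coefficients `c i`
(no compact support asked — the multiplicative half of `HasFiniteRankLeftType`). -/
def HasFiniteLeftTypeCont (f : G → ℂ) : Prop :=
  ∃ (r : ℕ) (e : Fin r → K → ℂ) (c : Fin r → G → ℂ), (∀ i, Continuous (c i)) ∧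
    ∀ (k : K) (g : G), f ((k : G)⁻¹ * g) = ∑ i, e i k * c i g

variable {K}

/-- a left-`K`-invariant continuous function has the algebraic type (rank `1`). -/
theorem HasFiniteLeftTypeCont.of_left_invariant {f : G → ℂ} (hf : Continuous f)
    (hinv : ∀ k ∈ K, ∀ g, f (k * g) = f g) : HasFiniteLeftTypeCont K f :=
  ⟨1, fun _ _ => 1, fun _ => f, fun _ => hf, fun k g => by
    rw [hinv ((k : G)⁻¹) (K.inv_mem k.2) g]
    simp⟩

/-- constants have the algebraic type. -/
theorem HasFiniteLeftTypeCont.const (a : ℂ) : HasFiniteLeftTypeCont K (fun _ : G => a) :=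
  HasFiniteLeftTypeCont.of_left_invariant continuous_const fun _ _ _ => rfl

/-- sums. -/
theorem HasFiniteLeftTypeCont.add {f f' : G → ℂ} (hf : HasFiniteLeftTypeCont K f)
    (hf' : HasFiniteLeftTypeCont K f') : HasFiniteLeftTypeCont K (fun g => f g + f' g) := by
  obtain ⟨r, e, c, hc, hdec⟩ := hf
  obtain ⟨r', e', c', hc', hdec'⟩ := hf'
  refine ⟨r + r', Fin.append e e', Fin.append c c', ?_, ?_⟩
  · intro i
    refine Fin.addCases (fun i => ?_) (fun i => ?_) i
    · simpa using hc i
    · simpa using hc' i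
  · intro k g
    simp only
    rw [hdec k g, hdec' k g, Fin.sum_univ_add]
    simp

/-- scalars. -/
theorem HasFiniteLeftTypeCont.const_mul {f : G → ℂ} (hf : HasFiniteLeftTypeCont K f) (a : ℂ) :
    HasFiniteLeftTypeCont K (fun g => a * f g) := by
  obtain ⟨r, e, c, hc, hdec⟩ := hf
  refine ⟨r, fun i k => a * e i k, c, hc, fun k g => ?_⟩
  simp only
  rw [hdec k g, Finset.mul_sum]
  exact Finset.sum_congr rfl fun i _ => by ring

/-- **products** (the ranks multiply). -/
theorem HasFiniteLeftTypeCont.mul {f f' : G → ℂ} (hf : HasFiniteLeftTypeCont K f)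
    (hf' : HasFiniteLeftTypeCont K f') : HasFiniteLeftTypeCont K (fun g => f g * f' g) := by
  obtain ⟨r, e, c, hc, hdec⟩ := hf
  obtain ⟨r', e', c', hc', hdec'⟩ := hf'
  refine ⟨r * r', fun x k => e (finProdFinEquiv.symm x).1 k * e' (finProdFinEquiv.symm x).2 k,
    fun x g => c (finProdFinEquiv.symm x).1 g * c' (finProdFinEquiv.symm x).2 g, fun x => (hc _).mul (hc' _),
    fun k g => ?_⟩
  simp only
  rw [hdec k g, hdec' k g, Finset.sum_mul_sum, ← (finProdFinEquiv (m := r) (n := r')).sum_comp]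
  simp only [Equiv.symm_apply_apply]
  rw [Fintype.sum_prod_type]
  refine Finset.sum_congr rfl fun i _ => Finset.sum_congr rfl fun j _ => by ring

/-- the `(i, j)` entry of a matrix-valued homomorphism with continuous entries has the algebraic type
(rank `d`, `e l k = A k⁻¹ i l`, `c l = A · l j`). -/
theorem HasFiniteLeftTypeCont.entry {d : ℕ} (A : G →* Matrix (Fin d) (Fin d) ℂ)
    (hA : ∀ i j, Continuous fun g => A g i j) (i j : Fin d) : HasFiniteLeftTypeCont K fun g => A g i j :=
  ⟨d, fun l k => A (k : G)⁻¹ i l, fun l g => A g l j, fun l => hA l j, fun k g => by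
    show A ((k : G)⁻¹ * g) i j = ∑ l, A (k : G)⁻¹ i l * A g l j
    rw [map_mul, Matrix.mul_apply]⟩

/-- the algebraic type is antitone in the subgroup. -/
theorem HasFiniteLeftTypeCont.mono {K' : Subgroup G} (hKK : K' ≤ K) {f : G → ℂ}
    (hf : HasFiniteLeftTypeCont K f) : HasFiniteLeftTypeCont K' f := by
  obtain ⟨r, e, c, hc, hdec⟩ := hf
  exact ⟨r, fun i k => e i ⟨k, hKK k.2⟩, c, hc, fun k g => hdec ⟨k, hKK k.2⟩ g⟩

/-- finite sums. -/
theorem HasFiniteLeftTypeCont.finset_sum {ι : Type} (F : Finset ι) (f : ι → G → ℂ)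
    (hf : ∀ i ∈ F, HasFiniteLeftTypeCont K (f i)) :
    HasFiniteLeftTypeCont K (fun g => ∑ i ∈ F, f i g) := by
  classical
  induction F using Finset.induction_on with
  | empty => simpa using HasFiniteLeftTypeCont.const (K := K) (0 : ℂ)
  | insert a F ha ih =>
    have h1 : HasFiniteLeftTypeCont K (f a) := hf a (Finset.mem_insert_self a F)
    have h2 : HasFiniteLeftTypeCont K (fun g => ∑ i ∈ F, f i g) :=
      ih fun i hi => hf i (Finset.mem_insert_of_mem hi)
    simpa [Finset.sum_insert ha] using h1.add h2

/-- **a function of algebraic type times a left-`K`-invariant test function has the finite-rank type of record**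
(the coefficients become test functions). -/
theorem HasFiniteLeftTypeCont.toFiniteRank {f : G → ℂ} (hf : HasFiniteLeftTypeCont K f) {ψ : G → ℂ}
    (hψ : IsTest ψ) (hψK : ∀ k ∈ K, ∀ g, ψ (k * g) = ψ g) :
    HasFiniteRankLeftType K (fun g => f g * ψ g) := by
  obtain ⟨r, e, c, hc, hdec⟩ := hf
  refine ⟨r, e, fun i g => c i g * ψ g, fun i => ⟨(hc i).mul hψ.cont, hψ.compact.mul_left⟩, fun k g => ?_⟩
  simp only
  rw [hdec k g, hψK _ (K.inv_mem k.2) g, Finset.sum_mul]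
  exact Finset.sum_congr rfl fun i _ => by ring

end Algebra

section Indicator

variable [IsTopologicalGroup G] [T2Space G]

omit [Group G] [IsTopologicalGroup G] in
/-- the indicator of a compact open set is a test function. -/
theorem isTest_indicator_of_isCompact_of_isOpen {s : Set G} (hc : IsCompact s) (ho : IsOpen s) :
    IsTest (s.indicator fun _ => (1 : ℂ)) := by
  refine ⟨?_, ?_⟩
  · refine continuous_const.indicator fun a ha => ?_
    rw [IsClopen.frontier_eq ⟨hc.isClosed, ho⟩] at ha
    exact (Set.notMem_empty a ha).elim
  · exact HasCompactSupport.intro' hc hc.isClosed fun x hx => Set.indicator_of_notMem hx _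

omit [TopologicalSpace G] [IsTopologicalGroup G] [T2Space G] in
/-- the indicator of a coset `z • K₂` is left-invariant under every `x` with `z⁻¹ x⁻¹ z ∈ K₂`. -/
theorem indicator_smul_left_invariant (K₂ : Subgroup G) (z : G) {x : G} (hx : z⁻¹ * x⁻¹ * z ∈ K₂) (g : G) :
    (z • (K₂ : Set G)).indicator (fun _ => (1 : ℂ)) (x * g) =
      (z • (K₂ : Set G)).indicator (fun _ => (1 : ℂ)) g := by
  have key : x * g ∈ z • (K₂ : Set G) ↔ g ∈ z • (K₂ : Set G) := by
    simp only [Set.mem_smul_set_iff_inv_smul_mem, smul_eq_mul, SetLike.mem_coe]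
    constructor
    · intro h
      have : z⁻¹ * g = (z⁻¹ * x⁻¹ * z) * (z⁻¹ * (x * g)) := by group
      rw [this]
      exact K₂.mul_mem hx h
    · intro h
      have : z⁻¹ * (x * g) = (z⁻¹ * x⁻¹ * z)⁻¹ * (z⁻¹ * g) := by group
      rw [this]
      exact K₂.mul_mem (K₂.inv_mem hx) h
  by_cases hg : g ∈ z • (K₂ : Set G)
  · rw [Set.indicator_of_mem (key.2 hg), Set.indicator_of_mem hg]
  · rw [Set.indicator_of_notMem (fun h => hg (key.1 h)), Set.indicator_of_notMem hg]

end Indicator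

end RTF

section Levels

open NumberField IsDedekindDomain Common Matrix

variable {k : Type} [Field k] [NumberField k] (W : PlaneData k)

/-- the finite-part congruence condition is antitone in the level. -/
theorem IsCongrFin.of_dvd {M N : ℕ} (h : M ∣ N) {A : M4 k} (hA : IsCongrFin k N A) : IsCongrFin k M A :=
  fun i j => modSet_antitone k h (hA i j)

/-- **`K_f(N) × G(k_∞)` is antitone in the level**. -/
theorem finLevel_antitone {M N : ℕ} (h : M ∣ N) : finLevel W N ≤ finLevel W M := by
  intro g hg
  obtain ⟨h1, h2⟩ := (mem_finLevel W N g).1 hg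
  exact ⟨IsCongrFin.of_dvd h h1, IsCongrFin.of_dvd h h2⟩

/-- `G(k_∞) ≤ K_f(N) × G(k_∞)` for every level. -/
theorem infinitePart_le_finLevel (N : ℕ) : infinitePart W ≤ finLevel W N := by
  intro g hg
  rw [mem_infinitePart] at hg
  have hg' : finM k (GA.mat W g⁻¹) = 1 := by
    have h := congrArg (finM k) (GA.mat_inv_mul W g)
    rwa [finM_mul, finM_one, hg, Matrix.mul_one] at h
  rw [mem_finLevel]
  refine ⟨fun i j => ?_, fun i j => ?_⟩
  · rw [mem_finCongrSet, Matrix.sub_apply, map_sub]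
    have e1 : finPart k (GA.mat W g i j) = finPart k ((1 : M4 k) i j) :=
      (congrFun (congrFun hg i) j).trans (congrFun (congrFun (finM_one (k := k)) i) j).symm
    rw [e1, sub_self]
    exact zero_mem_modSet k N
  · rw [mem_finCongrSet, Matrix.sub_apply, map_sub]
    have e1 : finPart k (GA.mat W g⁻¹ i j) = finPart k ((1 : M4 k) i j) :=
      (congrFun (congrFun hg' i) j).trans (congrFun (congrFun (finM_one (k := k)) i) j).symm
    rw [e1, sub_self]
    exact zero_mem_modSet k N

/-- `G(k_∞)` is normal: the finite part of a conjugate of an archimedean element is `1`. -/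
theorem conj_mem_infinitePart {g : GA W} (hg : g ∈ infinitePart W) (z : GA W) :
    z⁻¹ * g * z ∈ infinitePart W := by
  rw [mem_infinitePart] at hg ⊢
  rw [GA.mat_mul, GA.mat_mul, finM_mul, finM_mul, hg, Matrix.mul_one, ← finM_mul, GA.mat_inv_mul, finM_one]

/-- **every level is conjugation-deep**: for `z` and a level `N₂ ≠ 0` there is a level `N₁ ≠ 0` with
`z⁻¹ (K_f(N₁) × G(k_∞)) z ⊆ K_f(N₂) × G(k_∞)` — the congruence subgroups `K(N₁)` are a neighbourhood basis of `1`
(typer-2's `exists_levelK_subset_nhds_one`) and `G(k_∞)` is normal and contained in every level. -/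
theorem exists_finLevel_conj_subset (z : GA W) {N₂ : ℕ} (hN₂ : N₂ ≠ 0) :
    ∃ N₁ : ℕ, N₁ ≠ 0 ∧ ∀ x ∈ finLevel W N₁, z⁻¹ * x * z ∈ finLevel W N₂ := by
  have hcont : Continuous fun x : GA W => z⁻¹ * x * z :=
    (continuous_const.mul continuous_id).mul continuous_const
  have hV : (fun x : GA W => z⁻¹ * x * z) ⁻¹' (finLevel W N₂ : Set (GA W)) ∈ 𝓝 (1 : GA W) := by
    refine hcont.continuousAt.preimage_mem_nhds ?_
    rw [mul_one, inv_mul_cancel]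
    exact (isOpen_finLevel W hN₂).mem_nhds (finLevel W N₂).one_mem
  obtain ⟨N₁, hN₁, hK⟩ := exists_levelK_subset_nhds_one W hV
  refine ⟨N₁, hN₁, fun x hx => ?_⟩
  rw [← GA.ofInfPart_mul_ofFinPart W x]
  have h1 : z⁻¹ * (GA.ofInfPart W x * GA.ofFinPart W x) * z =
      (z⁻¹ * GA.ofInfPart W x * z) * (z⁻¹ * GA.ofFinPart W x * z) := by group
  rw [h1]
  refine (finLevel W N₂).mul_mem ?_ ?_
  · exact infinitePart_le_finLevel W N₂ (conj_mem_infinitePart W (GA.ofInfPart_mem_infinitePart W x) z)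
  · exact hK (GA.ofFinPart_mem_levelK W hx)

/-- **the indicator of a level coset is left-invariant at a deeper level**: for `z` and `N₂ ≠ 0`, the indicator of
`z • (K_f(N₂) × G(k_∞))` is left-`K_f(N₁) × G(k_∞)`-invariant for the `N₁` of `exists_finLevel_conj_subset`. -/
theorem exists_indicator_smul_finLevel_left_invariant (z : GA W) {N₂ : ℕ} (hN₂ : N₂ ≠ 0) :
    ∃ N₁ : ℕ, N₁ ≠ 0 ∧ ∀ x ∈ finLevel W N₁, ∀ g,
      (z • (finLevel W N₂ : Set (GA W))).indicator (fun _ => (1 : ℂ)) (x * g) =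
        (z • (finLevel W N₂ : Set (GA W))).indicator (fun _ => (1 : ℂ)) g := by
  obtain ⟨N₁, hN₁, hconj⟩ := exists_finLevel_conj_subset W z hN₂
  exact ⟨N₁, hN₁, fun x hx g =>
    RTF.indicator_smul_left_invariant (finLevel W N₂) z (hconj _ ((finLevel W N₁).inv_mem hx)) g⟩

/-- the indicator of a level coset is a test function when the level is compact. -/
theorem isTest_indicator_smul_finLevel {N : ℕ} (hc : IsCompact (finLevel W N : Set (GA W))) (hN : N ≠ 0)
    (z : GA W) : RTF.IsTest ((z • (finLevel W N : Set (GA W))).indicator fun _ => (1 : ℂ)) := by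
  haveI : T2Space (GA W) := t2Space_GA W
  exact RTF.isTest_indicator_of_isCompact_of_isOpen (hc.smul z) ((isOpen_finLevel W hN).smul z)

end Levels

end Summit.Ventures.HodgeRepro.Tier4.Line1

end
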